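import Summits.CriticalPhenomena.PercolationContinuityZ3.Theorems.PercNearOneGluingNoHeavyLowerTailSunflowerAndrasfaiRecolour
import HarnessLib

/-!
# `NoHeavyLowerTail` (crux stmt-CriticalPhenomena-4575), abstract sunflower cubic: the ANDRÁSFAI GRAPHS ARE A-SAFE, part 4b — the induction on colour changes and the theorem `arcGraph_safe`

Support file (seat `prim-ineq-prove-1` gen 42; `--supports stmt-CriticalPhenomena-4575`).  No `sorry`, no named facts, standard axioms.
Memo: run/shared/lean/prim/prim-ineq-prove-1/FINDING-BLOWUP-prove1-g42.md §7 (the theorem and its proof).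

THE PROGRAMME (files `…SunflowerAndrasfai*`).  THEOREM (memo §7; `Arc.arcGraph_safe` in `…SunflowerAndrasfaiSafe`): for every `k`
the graph core of the Andrásfai graph (`arcGraph k` on `Fin (3k+2)`: adjacent iff in no common arc of `k+1` consecutive points) is
safe for every product measure — conjecture (And) of `…SunflowerAndrasfai`; hence (…SunflowerBlowup, …BlowupHom) so is the core
of every blow-up of an Andrásfai graph and of every maximal triangle-free graph homomorphic to one.  PROOF: polarisation
(`safe_arcGraph_of_colouring_ineq`, part 1b) reduces safety to `∏_j Λ(C_j) ≤ Λ(∅)^(K-1)` for colourings of the arc-starts; this is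
proved by induction on the number of colour changes (part 4): one of two adjacent LIGHT runs `X`, `Y` (`|X|+|Y| ≤ 2k+1`, `|Y| ≤ k`,
part 2b) is recoloured with the other's colour, which does not decrease the product by FACT 1/2 (part 2a) and the INTERVAL MERGING
LEMMA `w(X)·w(Y) ≤ Λ(∅)·z(X,Y)` (part 3: an explicit weight-preserving injection `Φ : W_X × W_Y → A × Z_{XY}`).

THIS FILE.  `step_algebra`, **`colouring_ineq`** (`∏_j Λ p (c⁻¹ j) ≤ Λ p ∅ ^ (K-1)` for every colouring, by induction on the number of
colour changes via the light pair, FACT 1/2, the Interval Merging Lemma and the recolouring step), and **`arcGraph_safe`**: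
`Safe p (edgeCore (arcGraph k))` for every `k` and every `p`.
-/

noncomputable section

namespace Summit.CriticalPhenomena.PercolationContinuityZ3.Theorems.SunflowerPartition

namespace SafeCalc

open Finset
open TwoGenCore (wmiss)

namespace Arc

variable {k : ℕ}

/-! ## The recolouring step and the induction -/

section Main2

variable (p : Fin (3 * k + 2) → unitInterval)

/-- The algebra of the recolouring step: with `wi = wX + wiX`, `wj = wY + wjY`, the Interval Merging Lemma `wX·wY ≤ a·zXY`,
`zXY ≤ z` and `wjY ≤ wiX`, one has `(a + wi)(a + wj) ≤ (a + wiX)(a + wj + wX + z)`. -/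
theorem step_algebra {a wX wiX wY wjY z zXY : ℝ} (ha : 0 ≤ a) (hwX : 0 ≤ wX) (hwiX : 0 ≤ wiX) (hz : 0 ≤ z)
    (hIML : wX * wY ≤ a * zXY) (hzz : zXY ≤ z) (hcase : wjY ≤ wiX) :
    (a + (wX + wiX)) * (a + (wY + wjY)) ≤ (a + wiX) * (a + ((wY + wjY) + wX + z)) := by
  have h2 : a * zXY ≤ a * z := mul_le_mul_of_nonneg_left hzz ha
  have h3 : wX * wjY ≤ wX * wiX := mul_le_mul_of_nonneg_left hcase hwX
  have h4 : 0 ≤ wiX * z := mul_nonneg hwiX hz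
  nlinarith [hIML, h2, h3, h4]

/-- **THE COLOURING INEQUALITY** `∏_j Λ p (c⁻¹ j) ≤ Λ p ∅ ^ (K-1)` for every colouring of the starts (memo §7 Step 1):
induction on the number of colour changes.  At most two colours: Harris.  Otherwise a light pair of adjacent runs `X` (after a
change `t`) and `Y` (after the next change, `|Y| ≤ k`, `|X|+|Y| ≤ 2k+1`) exists; recolouring `X` to the colour of `Y`, or `Y` to the
colour of `X` (whichever keeps `w_{C_j∖Y} ≤ w_{C_i∖X}` on the right side), does not decrease the product (FACT 1/2, the Interval
Merging Lemma, `step_algebra`) and has fewer colour changes. [this work] -/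
theorem colouring_ineq (D : ℕ) : ∀ {K : ℕ} (c : Fin (3 * k + 2) → Fin K), (univ.filter (IsChange c)).card ≤ D →
    ∏ l, lam p (cls c l) ≤ lam p ∅ ^ (K - 1) := by
  classical
  induction D with
  | zero =>
    intro K c hD
    -- no colour change: one colour
    have h1 : ∀ x, c x = c 0 := by
      intro x; by_contra hx
      obtain ⟨t, ht⟩ := exists_change_of_ne c hx
      have : t ∈ univ.filter (IsChange c) := mem_filter.2 ⟨mem_univ _, ht⟩
      rw [Nat.le_zero, card_eq_zero] at hD
      rw [hD] at this; exact absurd this (notMem_empty _)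
    exact colouring_ineq_two p c (c 0) (c 0) fun x => Or.inl (h1 x)
  | succ D ih =>
    intro K c hD
    by_cases h3 : ∃ u v w, c u ≠ c v ∧ c v ≠ c w ∧ c u ≠ c w
    swap
    · obtain ⟨i, j, hij⟩ := two_colours_of_not_three c h3
      exact colouring_ineq_two p c i j hij
    have h2 : ∃ u v, c u ≠ c v := by obtain ⟨u, v, w, h, -, -⟩ := h3; exact ⟨u, v, h⟩
    obtain ⟨t, ht, hsum, ht2⟩ := exists_light_change c h3
    -- the two runs
    set l1 := nxt c t with hl1
    set t' := sh t l1 with ht'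
    set l2 := nxt c t' with hl2
    set t'' := sh t' l2 with ht''
    have hl1p : 1 ≤ l1 := one_le_nxt c t
    have hl2p : 1 ≤ l2 := one_le_nxt c t'
    have ht'c : IsChange c t' := isChange_sh_nxt c ht
    have ht''c : IsChange c t'' := isChange_sh_nxt c ht'c
    have hN : l1 + l2 + 1 < 3 * k + 2 := by omega
    set i := c (sh t 1) with hi
    set j := c (sh t' 1) with hj
    have hct' : c t' = i := colour_stretch c t hl1p le_rfl
    have hct'' : c t'' = j := colour_stretch c t' hl2p le_rfl
    have hij : i ≠ j := by rw [← hct']; exact ht'c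
    set X := ivl t 1 l1 with hX
    set Y := ivl t' 1 l2 with hY
    have hXi : X ⊆ cls c i := fun x hx => by rw [cls, mem_filter]; exact ⟨mem_univ _, colour_of_mem_ivl c t hx⟩
    have hYj : Y ⊆ cls c j := fun x hx => by rw [cls, mem_filter]; exact ⟨mem_univ _, colour_of_mem_ivl c t' hx⟩
    have hXj : Disjoint X (cls c j) := by
      rw [Finset.disjoint_left]; intro x hx hx'
      have := hXi hx; rw [cls, mem_filter] at this hx'; exact hij (this.2.symm.trans hx'.2)
    have hYi : Disjoint Y (cls c i) := by
      rw [Finset.disjoint_left]; intro x hx hx'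
      have := hYj hx; rw [cls, mem_filter] at this hx'; exact hij (hx'.2.symm.trans this.2)
    -- the runs in the coordinates of the Interval Merging Lemma (origin `sh t 1`)
    have eX : X = ivl (sh t 1) 0 (l1 - 1) := by
      have := ivl_shift' (k := k) t (a := 1) (lo := 0) (hi := l1 - 1) (by omega)
      rwa [show 1 + 0 = 1 from rfl, show 1 + (l1 - 1) = l1 by omega] at this
    have eY : Y = ivl (sh t 1) l1 (l1 + l2 - 1) := by
      have e1 := ivl_shift (k := k) t (a := l1) (b := l2) (by omega)
      have e2 := ivl_shift' (k := k) t (a := 1) (lo := l1) (hi := l1 + l2 - 1) (by omega)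
      rw [show 1 + l1 = l1 + 1 by omega, show 1 + (l1 + l2 - 1) = l1 + l2 by omega] at e2
      rw [hY, ht', ← e1, e2]
    have hIML : wset p X * wset p Y ≤ lam p ∅ * zset p X Y := by
      rw [eX, eY]; exact iml p hl1p hl2p ht2 hsum
    -- FACT 1 for both runs
    have hF1X : wset p (cls c i) = wset p X + wset p (cls c i \ X) := by
      refine wset_split p hXi (U_subset_run (by omega) ?_ ?_)
      · rw [cls, mem_filter]; exact fun h => ht h.2
      · have e : sh t (l1 + 1) = sh t' 1 := by rw [ht', sh_sh t l1 1]
        rw [e, cls, mem_filter]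
        intro h
        exact ht'c (hct'.trans h.2.symm)
    have hF1Y : wset p (cls c j) = wset p Y + wset p (cls c j \ Y) := by
      refine wset_split p hYj (U_subset_run (by omega) ?_ ?_)
      · rw [cls, mem_filter]; exact fun h => hij (hct'.symm.trans h.2)
      · have e : sh t' (l2 + 1) = sh t'' 1 := by rw [ht'', sh_sh t' l2 1]
        rw [e, cls, mem_filter]
        intro h
        exact ht''c (hct''.trans h.2.symm)
    have ha := lam_nonneg (k := k) p ∅
    -- the two cases
    rcases le_total (wset p (cls c j \ Y)) (wset p (cls c i \ X)) with hcase | hcase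
    · -- recolour X with colour j
      set c₁ := recol c X j with hc₁
      have hlt : (univ.filter (IsChange c₁)).card < (univ.filter (IsChange c)).card :=
        card_changes_recol_lt c ht h2 j (Or.inl (by rw [hj, ht', sh_sh]))
      have IH := ih c₁ (by omega)
      refine le_trans ?_ IH
      refine prod_le_prod_of_pair i j hij (fun l => lam_nonneg p _) (fun l hli hlj => ?_) ?_
      · rw [hc₁, cls_recol c X i j l hXi, if_neg hlj, if_neg hli]
      · rw [hc₁, cls_recol c X i j i hXi, cls_recol c X i j j hXi, if_neg hij, if_pos rfl, if_pos rfl,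
          lam_eq p (cls c i), lam_eq p (cls c j), lam_eq p (cls c i \ X), lam_eq p (cls c j ∪ X), hF1X, hF1Y,
          wset_union p hXj]
        rw [hF1Y]
        exact step_algebra ha (wset_nonneg p _) (wset_nonneg p _) (zset_nonneg p _ _) hIML (zset_mono p hYj) hcase
    · -- recolour Y with colour i
      set c₂ := recol c Y i with hc₂
      have hlt : (univ.filter (IsChange c₂)).card < (univ.filter (IsChange c)).card :=
        card_changes_recol_lt c ht'c h2 i (Or.inr hct'.symm)
      have IH := ih c₂ (by omega)
      refine le_trans ?_ IH
      refine prod_le_prod_of_pair j i hij.symm (fun l => lam_nonneg p _) (fun l hlj hli => ?_) ?_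
      · rw [hc₂, cls_recol c Y j i l hYj, if_neg hli, if_neg hlj]
      · rw [hc₂, cls_recol c Y j i j hYj, cls_recol c Y j i i hYj, if_neg hij.symm, if_pos rfl, if_pos rfl,
          lam_eq p (cls c j), lam_eq p (cls c i), lam_eq p (cls c j \ Y), lam_eq p (cls c i ∪ Y), hF1X, hF1Y,
          wset_union p hYi]
        rw [hF1X]
        have hIML' : wset p Y * wset p X ≤ lam p ∅ * zset p Y X := by rw [mul_comm, zset_comm]; exact hIML
        exact step_algebra ha (wset_nonneg p _) (wset_nonneg p _) (zset_nonneg p _ _) hIML' (zset_mono p hXi) hcase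

/-- **THEOREM (conjecture (And), arc form).**  The graph core of the Andrásfai graph `arcGraph k` on `Fin (3k+2)` is safe for every
product measure. [this work] -/
theorem arcGraph_safe (k : ℕ) (p : Fin (3 * k + 2) → unitInterval) : Safe p (edgeCore (arcGraph k)) :=
  safe_arcGraph_of_colouring_ineq p fun _ c _ => colouring_ineq p _ c le_rfl

end Main2

end Arc

end SafeCalc

end Summit.CriticalPhenomena.PercolationContinuityZ3.Theorems.SunflowerPartition
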